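import Summits.Ventures.PercRepro.C041BlockMapWedgeHost

/-!
# ROW C-041 — THEOREM (WEDGE): the block map of two hosts glued at their anchors is the product of their block
maps (p6, gen 34; mine-3's «Π is multiplicative over the blocks at the anchor» at the level of hosts)

Setting of `C041BlockMapWedgeHost` (the wedge `wedge Za Zb a₁ a₂`, the redirection `redW`, the path lemmas
and the statuses).  The exits of the wedge are `wexits a₁ a₂ u₁ u₂ = Sum.elim (inl ∘ u₁) (redW ∘ u₂)`, its
anchor `inl a₁`.  Every exit has the status it has on its own side, so the merged set and the blocks split by
side (`merged_wedge`, `blocks_wedge`), the colouring term of `(ω₁, ω₂)` is the product of the two colouring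
terms (`colTerm_wedge`), and **`blockMap_wedge`: the block map of the wedge at `w` is the product of the block
maps of the two hosts at `w ∘ inl` and `w ∘ inr`**.  COROLLARY (`inCone_blockMap_wedge`): the cone conjecture
for block maps is closed under wedging at the anchor (the cone is closed under products); with THEOREM
(SUBDIVISION) and the reductions of `C041BlockMapReductions`, CONJECTURE (BLOCK MAP) for every host follows
from the hosts that are 2-connected at the anchor with every non-terminal vertex of degree `≥ 3`.
-/

namespace PercRepro

namespace ZoneZ

namespace MultiExit

open ZoneData Pendant Finset TwoExit TreeClosure

variable {V₁ E₁ U₁ W₁ V₂ E₂ U₂ W₂ : Type} (Za : ZoneData V₁ E₁ U₁ W₁) (Zb : ZoneData V₂ E₂ U₂ W₂)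
  (a₁ : V₁) (a₂ : V₂) [DecidableEq V₂]

/-! ## The merged set and the blocks split by side -/

section Sets

variable {ι₁ ι₂ : Type} (u₁ : ι₁ → V₁) (u₂ : ι₂ → V₂)

/-- The exits of the wedge: the left exits and the redirected right exits. -/
def wexits : ι₁ ⊕ ι₂ → V₁ ⊕ V₂ := Sum.elim (fun k => Sum.inl (u₁ k)) fun k => redW a₁ a₂ (u₂ k)

/-- A left exit. -/
theorem wexits_inl (k : ι₁) : wexits a₁ a₂ u₁ u₂ (Sum.inl k) = Sum.inl (u₁ k) := rfl
/-- A right exit. -/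
theorem wexits_inr (k : ι₂) : wexits a₁ a₂ u₁ u₂ (Sum.inr k) = redW a₁ a₂ (u₂ k) := rfl

variable [Fintype ι₁] [Fintype ι₂] (ω : E₁ ⊕ E₂ → Bool)

/-- The block of a left exit is the image of its block in `Za`. -/
theorem blk_wedge_inl (k : ι₁) :
    blk (wedge Za Zb a₁ a₂) (wexits a₁ a₂ u₁ u₂) (Sum.inl a₁) ω (Sum.inl k) =
      (blk Za u₁ a₁ (fun e => ω (Sum.inl e)) k).map Function.Embedding.inl := by
  ext l
  rw [Finset.mem_map, mem_blk, wexits_inl]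
  rcases l with l | l
  · rw [wexits_inl, Mg_wedge_anchor_inl, Mg_wedge_inl]
    constructor
    · intro h
      exact ⟨l, (mem_blk Za u₁ a₁ _ k l).2 h, rfl⟩
    · rintro ⟨a, ha, hal⟩
      rw [Function.Embedding.inl_apply] at hal
      obtain rfl := Sum.inl.inj hal
      exact (mem_blk Za u₁ a₁ _ k a).1 ha
  · rw [wexits_inr, Mg_wedge_anchor_red, Mg_wedge_inl_red]
    constructor
    · rintro ⟨h1, -, h2⟩
      exact absurd h2 h1
    · rintro ⟨a, -, ha⟩
      rw [Function.Embedding.inl_apply] at ha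
      exact absurd ha Sum.inl_ne_inr

/-- The block of a right exit is the image of its block in `Zb`. -/
theorem blk_wedge_inr (k : ι₂) :
    blk (wedge Za Zb a₁ a₂) (wexits a₁ a₂ u₁ u₂) (Sum.inl a₁) ω (Sum.inr k) =
      (blk Zb u₂ a₂ (fun e => ω (Sum.inr e)) k).map Function.Embedding.inr := by
  ext l
  rw [Finset.mem_map, mem_blk, wexits_inr]
  rcases l with l | l
  · rw [wexits_inl, Mg_wedge_anchor_inl, Mg_wedge_red_inl]
    constructor
    · rintro ⟨h1, h2, -⟩
      exact absurd (Mg_symm Za _ _ _ h2) h1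
    · rintro ⟨a, -, ha⟩
      rw [Function.Embedding.inr_apply] at ha
      exact absurd ha Sum.inr_ne_inl
  · rw [wexits_inr, Mg_wedge_anchor_red, Mg_wedge_red]
    constructor
    · intro h
      exact ⟨l, (mem_blk Zb u₂ a₂ _ k l).2 h, rfl⟩
    · rintro ⟨a, ha, hal⟩
      rw [Function.Embedding.inr_apply] at hal
      obtain rfl := Sum.inr.inj hal
      exact (mem_blk Zb u₂ a₂ _ k a).1 ha

/-- The blocks of the wedge are nonempty (as every block). -/
theorem blocks_wedge_nonempty {B : Finset (ι₁ ⊕ ι₂)}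
    (hB : B ∈ blocks (wedge Za Zb a₁ a₂) (wexits a₁ a₂ u₁ u₂) (Sum.inl a₁) ω) : B.Nonempty := by
  obtain ⟨k, hk, rfl⟩ := (mem_blocks _ _ _ ω B).1 hB
  exact ⟨k, self_mem_blk _ _ _ ω k hk⟩

variable [DecidableEq ι₁] [DecidableEq ι₂]

omit [Fintype ι₁] [Fintype ι₂] [DecidableEq ι₁] [DecidableEq ι₂] in
/-- Left and right images are disjoint. -/
theorem disjoint_map_inl_inr (s : Finset ι₁) (t : Finset ι₂) :
    Disjoint (s.map (Function.Embedding.inl : ι₁ ↪ ι₁ ⊕ ι₂)) (t.map (Function.Embedding.inr : ι₂ ↪ ι₁ ⊕ ι₂)) := by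
  rw [Finset.disjoint_left]
  intro k hk hk'
  rw [Finset.mem_map] at hk hk'
  obtain ⟨a, -, rfl⟩ := hk
  obtain ⟨b, -, hb⟩ := hk'
  rw [Function.Embedding.inr_apply, Function.Embedding.inl_apply] at hb
  exact Sum.inr_ne_inl hb

/-- **The merged set of the wedge** is the union of the two merged sets. -/
theorem merged_wedge :
    merged (wedge Za Zb a₁ a₂) (wexits a₁ a₂ u₁ u₂) (Sum.inl a₁) ω =
      (merged Za u₁ a₁ fun e => ω (Sum.inl e)).map Function.Embedding.inl ∪
        (merged Zb u₂ a₂ fun e => ω (Sum.inr e)).map Function.Embedding.inr := by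
  ext k
  rw [Finset.mem_union, Finset.mem_map, Finset.mem_map, mem_merged]
  rcases k with k | k
  · rw [wexits_inl, Mg_wedge_anchor_inl]
    constructor
    · intro h
      exact Or.inl ⟨k, (mem_merged Za u₁ a₁ _ k).2 h, rfl⟩
    · rintro (⟨a, ha, hak⟩ | ⟨a, -, hak⟩)
      · rw [Function.Embedding.inl_apply] at hak
        obtain rfl := Sum.inl.inj hak
        exact (mem_merged Za u₁ a₁ _ a).1 ha
      · rw [Function.Embedding.inr_apply] at hak
        exact absurd hak Sum.inr_ne_inl
  · rw [wexits_inr, Mg_wedge_anchor_red]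
    constructor
    · intro h
      exact Or.inr ⟨k, (mem_merged Zb u₂ a₂ _ k).2 h, rfl⟩
    · rintro (⟨a, -, hak⟩ | ⟨a, ha, hak⟩)
      · rw [Function.Embedding.inl_apply] at hak
        exact absurd hak Sum.inl_ne_inr
      · rw [Function.Embedding.inr_apply] at hak
        obtain rfl := Sum.inr.inj hak
        exact (mem_merged Zb u₂ a₂ _ a).1 ha

/-- **The blocks of the wedge** are the images of the blocks of the two sides. -/
theorem blocks_wedge :
    blocks (wedge Za Zb a₁ a₂) (wexits a₁ a₂ u₁ u₂) (Sum.inl a₁) ω =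
      (blocks Za u₁ a₁ fun e => ω (Sum.inl e)).map (Finset.mapEmbedding Function.Embedding.inl).toEmbedding ∪
        (blocks Zb u₂ a₂ fun e => ω (Sum.inr e)).map (Finset.mapEmbedding Function.Embedding.inr).toEmbedding := by
  ext B
  rw [Finset.mem_union, Finset.mem_map, Finset.mem_map, mem_blocks]
  simp only [RelEmbedding.coe_toEmbedding, Finset.mapEmbedding_apply, mem_blocks]
  constructor
  · rintro ⟨k, hk, rfl⟩
    rcases k with k | k
    · rw [wexits_inl, Mg_wedge_anchor_inl] at hk
      exact Or.inl ⟨_, ⟨k, hk, rfl⟩, (blk_wedge_inl Za Zb a₁ a₂ u₁ u₂ ω k).symm⟩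
    · rw [wexits_inr, Mg_wedge_anchor_red] at hk
      exact Or.inr ⟨_, ⟨k, hk, rfl⟩, (blk_wedge_inr Za Zb a₁ a₂ u₁ u₂ ω k).symm⟩
  · rintro (⟨B₁, ⟨k, hk, rfl⟩, rfl⟩ | ⟨B₂, ⟨k, hk, rfl⟩, rfl⟩)
    · refine ⟨Sum.inl k, ?_, blk_wedge_inl Za Zb a₁ a₂ u₁ u₂ ω k⟩
      rw [wexits_inl, Mg_wedge_anchor_inl]
      exact hk
    · refine ⟨Sum.inr k, ?_, blk_wedge_inr Za Zb a₁ a₂ u₁ u₂ ω k⟩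
      rw [wexits_inr, Mg_wedge_anchor_red]
      exact hk

omit [DecidableEq V₂] [DecidableEq ι₁] [DecidableEq ι₂] in
/-- The two families of blocks are disjoint. -/
theorem blocks_wedge_disjoint :
    Disjoint
      ((blocks Za u₁ a₁ fun e => ω (Sum.inl e)).map (Finset.mapEmbedding Function.Embedding.inl).toEmbedding)
      ((blocks Zb u₂ a₂ fun e => ω (Sum.inr e)).map (Finset.mapEmbedding Function.Embedding.inr).toEmbedding) := by
  rw [Finset.disjoint_left]
  intro B hB₁ hB₂
  rw [Finset.mem_map] at hB₁ hB₂
  obtain ⟨B₁, hB₁, rfl⟩ := hB₁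
  obtain ⟨B₂, hB₂, hB⟩ := hB₂
  simp only [RelEmbedding.coe_toEmbedding, Finset.mapEmbedding_apply] at hB
  obtain ⟨k, hk, rfl⟩ := (mem_blocks _ _ _ _ B₁).1 hB₁
  have hmem : Sum.inl k ∈ (blk Za u₁ a₁ (fun e => ω (Sum.inl e)) k).map (Function.Embedding.inl : ι₁ ↪ ι₁ ⊕ ι₂) :=
    Finset.mem_map_of_mem _ (self_mem_blk _ _ _ _ k hk)
  rw [← hB, Finset.mem_map] at hmem
  obtain ⟨l, -, hl⟩ := hmem
  exact Sum.inr_ne_inl hl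



end Sets

/-! ## THEOREM (WEDGE) -/

section Main

variable {ι₁ ι₂ : Type} (u₁ : ι₁ → V₁) (u₂ : ι₂ → V₂) [Fintype ι₁] [Fintype ι₂] [DecidableEq ι₁] [DecidableEq ι₂]

/-- **The colouring term of the wedge is the product of the colouring terms of the two sides.** -/
theorem colTerm_wedge (ω : E₁ ⊕ E₂ → Bool) (w : ι₁ ⊕ ι₂ → Vec6) :
    colTerm (wedge Za Zb a₁ a₂) (wexits a₁ a₂ u₁ u₂) (Sum.inl a₁) ω w =
      colTerm Za u₁ a₁ (fun e => ω (Sum.inl e)) (fun k => w (Sum.inl k)) *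
        colTerm Zb u₂ a₂ (fun e => ω (Sum.inr e)) (fun k => w (Sum.inr k)) := by
  unfold colTerm
  rw [merged_wedge, blocks_wedge, Finset.prod_union (disjoint_map_inl_inr _ _),
    Finset.prod_union (blocks_wedge_disjoint Za Zb a₁ a₂ u₁ u₂ ω), Finset.prod_map, Finset.prod_map,
    Finset.prod_map, Finset.prod_map, mul_mul_mul_comm]
  simp only [Function.Embedding.inl_apply, Function.Embedding.inr_apply, RelEmbedding.coe_toEmbedding,
    Finset.mapEmbedding_apply, Finset.prod_map, wexits_inl, wexits_inr, Rd_wedge_anchor_inl, Rd_wedge_anchor_red]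

variable [Fintype E₁] [DecidableEq E₁] [Fintype E₂] [DecidableEq E₂]

/-- **THEOREM (WEDGE)**: the block map of the wedge of two hosts at their anchors is the product of the two
block maps. -/
theorem blockMap_wedge (w : ι₁ ⊕ ι₂ → Vec6) :
    blockMap (wedge Za Zb a₁ a₂) (wexits a₁ a₂ u₁ u₂) (Sum.inl a₁) w =
      blockMap Za u₁ a₁ (fun k => w (Sum.inl k)) * blockMap Zb u₂ a₂ fun k => w (Sum.inr k) := by
  rw [blockMap_eq_sum_colTerm, blockMap_eq_sum_colTerm, blockMap_eq_sum_colTerm, Finset.sum_mul_sum,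
    ← Fintype.sum_equiv (Equiv.sumArrowEquivProdArrow E₁ E₂ Bool).symm
      (fun p => colTerm (wedge Za Zb a₁ a₂) (wexits a₁ a₂ u₁ u₂) (Sum.inl a₁)
        ((Equiv.sumArrowEquivProdArrow E₁ E₂ Bool).symm p) w) _ (fun _ => rfl),
    Fintype.sum_prod_type]
  refine Finset.sum_congr rfl fun ω₁ _ => Finset.sum_congr rfl fun ω₂ _ => ?_
  exact colTerm_wedge Za Zb a₁ a₂ u₁ u₂ (Sum.elim ω₁ ω₂) w

/-- **The cone conjecture for block maps is closed under wedging at the anchor.** -/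
theorem inCone_blockMap_wedge (w : ι₁ ⊕ ι₂ → Vec6) (h₁ : InCone (blockMap Za u₁ a₁ fun k => w (Sum.inl k)))
    (h₂ : InCone (blockMap Zb u₂ a₂ fun k => w (Sum.inr k))) :
    InCone (blockMap (wedge Za Zb a₁ a₂) (wexits a₁ a₂ u₁ u₂) (Sum.inl a₁) w) := by
  rw [blockMap_wedge]
  exact h₁.mul h₂

end Main

end MultiExit

end ZoneZ

end PercRepro
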